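import Summits.CriticalPhenomena.PercolationContinuityZ3.Theorems.Transplant.FKConnectivityAllQAntipodalFKG
import Literature.Probability.LatticeModels.FKInterfacePairing
import HarnessLib

/-!
# Connectivity correlation inequalities for `φ_{w,q}` — file (DEFINITION): the SPLIT antipodal functional `V`, the four-terminal
# cross functional `X2`, the `(1 - q)`-factorisation `q·V = q·U + (1 - q)·X2`, and the conjecture node `ApX2Pos`

Definitions file (`--supports stmt-CriticalPhenomena-4575`), FK sub-lane `prim-bschramm-fk-2` (gen 12) of the post-continuity
programme; builds on p205010 (kernel theorem, internal audit signed; external expert review pending).  No named facts, no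
sorries, standard axioms; one statement is recorded `@[conjecture]` (NOT asserted).

CONTEXT (memo `bschramm/FROM-fk-2-g12-SPLIT-UPC.md`, FK-Q2.md §21).  Gen 11 reduced the next level of the coefficientwise
negative-association programme for `φ_{q<1}` on series–parallel graphs (Conjecture `C_∞` at `|supp f| = 3`, majority type) to the
SPLIT up-correlation inequality `U¹¹ ≥ 0` (`q ≤ 1`): the antipodal up-correlation functional of `…AntipodalDefs` restricted to the
complementary pairs that SPLIT two marked edges `y, z`.  Its simplest instance, `y` in series with the rest (`N = y · M`), is
`q · apV` below, where for an edge set `T` (think `T = E(M) ∖ z`), terminals `s, t` and the end-points `u, v` of the marked edge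
* `FK.apV q T s t u v g  = ∑_{B ⊆ T} q^{k(B) + k((T∖B) ∪ {uv})} · 1{s ↔ t in B} · (g(B) - g(T∖B))` — the marked edge is counted on the
  side of the complement (in the cluster exponent only);
* `FK.apX2 q T s t u v g = ∑_{B ⊆ T} q^{k(B) + k(T∖B)} · 1{s ↔ t in B} · 1{u ↮ v in T∖B} · (g(B) - g(T∖B))` — a FOUR-terminal,
  `q`-twist-free antipodal functional ("`B` joins the terminals and its complement separates the marked pair").
PROVED HERE (kernel):
* `FK.apV_eq` — the factorisation `q · apV = q · apUpc q T s t g + (1 - q) · apX2` (opening the marked edge on the complement's side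
  lowers its cluster count by `1{u ↮ v in T∖B}`, `clusterCount_insert`);
* `FK.apX2_eq_half_apPsi` — `apX2 = ½ · apPsi q T f g` with the increasing `f(B) = 1{s ↔ t in B}·1{u ↮ v in T∖B}`, hence
  `FK.apX2_nonneg_of_one_le` — `apX2 ≥ 0` for `q ≥ 1` on EVERY finite graph (FKG for the antipodal weight, `…AntipodalFKG`);
* `FK.apV_nonneg_of_apX2_nonneg` — for `0 < q ≤ 1` and `T` a sub-network of a two-terminal series–parallel network between `s, t`,
  `apX2 ≥ 0` implies `apV ≥ 0` (Theorem U `apUpc_nonneg_of_isTTSP` + the factorisation).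
RECORDED, NOT ASSERTED: `FK.ApX2Pos` — `apX2 ≥ 0` for every `q > 0` on (sub-networks of) two-terminal series–parallel networks with
the marked pair joined by an edge of the network.  Evidence (memo §2): exact COEFFICIENTWISE verification on all such networks with
`≤ 6` edges and all monotone Boolean `g` (7.6·10⁶ cells) and 1.1·10⁵ random cells with `≤ 9` edges, 0 negative coefficients; for
`q ≥ 1` it is the theorem `apX2_nonneg_of_one_le`; and a reduction (memo §4) to a Hall-type condition on words verified for all
spine shapes of length `≤ 8`.  No finite-state induction over the series–parallel decomposition proves it (memo §3, an LP
certificate of infeasibility), which is why it is recorded as a node and not attempted here.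
[cite: Grimmett2006, §1.4 eq. (1.20) (p. 15); Thm. 3.8, eq. (3.12) (p. 40); §3.9 (p. 63)] [cite: FortuinKasteleynGinibre1971, Thm. (Prop. 1)]
-/

noncomputable section

namespace Summit.CriticalPhenomena.PercolationContinuityZ3.Theorems

namespace FK

open SimpleGraph Literature.Probability.LatticeModels Literature.Probability.Percolation
open scoped Classical

variable {V : Type*}

/-! ### Definitions -/

/-- **Split antipodal functional** of the edge set `T` with terminals `s, t` and marked pair `u, v`:
`apV q T s t u v g = ∑_{B ⊆ T} q^{k(B) + k((T ∖ B) ∪ {uv})} · 1{s ↔ t in B} · (g(B) - g(T ∖ B))` (cluster counts on all of `V`,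
free boundary; the marked edge `uv` is opened on the complement's side).  For a two-terminal series–parallel network `M ∋ z = uv`
and `T = E(M) ∖ z`, `q · apV` is the split up-correlation functional `U¹¹` of the series composition `y · M` (memo §1).
[cite: Grimmett2006, §1.4 eq. (1.20) (p. 15); §3.8 (pp. 61–62)] -/
def apV (q : ℝ) (T : Finset (Sym2 V)) (s t u v : V) (g : Finset (Sym2 V) → ℝ) : ℝ :=
  ∑ B ∈ T.powerset,
    q ^ (clusterCount (↑B : BondConfig V) ∅ + clusterCount (↑(insert s(u, v) (T \ B)) : BondConfig V) ∅) *
      (apConn B s t * (g B - g (T \ B)))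

/-- **Four-terminal cross functional** `apX2 q T s t u v g = ∑_{B ⊆ T} q^{k(B)+k(T∖B)} · 1{s ↔ t in B} · 1{u ↮ v in T ∖ B} · (g(B) - g(T∖B))`:
the antipodal weight of `T` against the pairs whose first member joins the terminals while the second separates the marked pair.
[cite: Grimmett2006, §1.4 eq. (1.20) (p. 15); §3.9 (p. 63)] -/
def apX2 (q : ℝ) (T : Finset (Sym2 V)) (s t u v : V) (g : Finset (Sym2 V) → ℝ) : ℝ :=
  ∑ B ∈ T.powerset, q ^ apExp T B * (apConn B s t * (1 - apConn (T \ B) u v) * (g B - g (T \ B)))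

/-- **Conjecture node `ApX2Pos` (NOT asserted): the cross functional is nonnegative for every `q > 0` on two-terminal
series–parallel networks** — for `E` TTSP between `s, t`, a marked edge `uv ∈ E`, any sub-network `T ⊆ E ∖ {uv}` and every `g`
monotone on the subsets of `T`, `0 ≤ apX2 q T s t u v g`.  Proved for `q ≥ 1` on every graph (`apX2_nonneg_of_one_le`); for
`q < 1` verified coefficientwise by exhaustive exact computation (`≤ 6` edges) and reduced to a word problem (memo
`bschramm/FROM-fk-2-g12-SPLIT-UPC.md` §§2–4); no statement of this kind for `q < 1` was found in print (Grimmett 2006 §3.9 lists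
the negative-dependence questions for `q < 1` as open). [cite: Grimmett2006, §3.9 (p. 63)] -/
@[conjecture] def ApX2Pos : Prop :=
  ∀ (n : ℕ) (q : ℝ), 0 < q → ∀ (E : Finset (Sym2 (Fin n))) (s t u v : Fin n), IsTTSP E s t → s(u, v) ∈ E →
    ∀ T : Finset (Sym2 (Fin n)), T ⊆ E.erase s(u, v) → ∀ g : Finset (Sym2 (Fin n)) → ℝ,
      (∀ ⦃A B : Finset (Sym2 (Fin n))⦄, A ⊆ B → B ⊆ T → g A ≤ g B) → 0 ≤ apX2 q T s t u v g

/-! ### The cross functional is half an antipodal covariance form; nonnegativity for `q ≥ 1` -/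

section CrossForm

variable [Fintype V]

omit [Fintype V] in
/-- **`apX2 = ½ · apPsi q T f g`** with `f(B) = 1{s ↔ t in B} · 1{u ↮ v in T ∖ B}`: the summand of `apX2` is odd under `B ↦ T ∖ B`
up to the factor `g(B) - g(T∖B)`, so symmetrising over the involution gives the covariance form of `…AntipodalDefs`. [folklore] -/
theorem apX2_eq_half_apPsi (q : ℝ) (T : Finset (Sym2 V)) (s t u v : V) (g : Finset (Sym2 V) → ℝ) :
    apX2 q T s t u v g =
      (1 / 2) * apPsi q T (fun B => apConn B s t * (1 - apConn (T \ B) u v)) g := by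
  unfold apX2 apPsi
  have flip := sum_powerset_flip T
    (fun B => q ^ apExp T B * (apConn B s t * (1 - apConn (T \ B) u v) * (g B - g (T \ B))))
  have e2 : ∑ B ∈ T.powerset, q ^ apExp T (T \ B) *
      (apConn (T \ B) s t * (1 - apConn (T \ (T \ B)) u v) * (g (T \ B) - g (T \ (T \ B)))) =
      - ∑ B ∈ T.powerset, q ^ apExp T B * (apConn (T \ B) s t * (1 - apConn B u v) * (g B - g (T \ B))) := by
    rw [← Finset.sum_neg_distrib]
    refine Finset.sum_congr rfl fun B hB => ?_
    have hBT := Finset.mem_powerset.1 hB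
    rw [Finset.sdiff_sdiff_eq_self hBT, apExp_compl hBT]; ring
  rw [e2] at flip
  have e3 : ∑ B ∈ T.powerset, q ^ apExp T B *
      (((apConn B s t * (1 - apConn (T \ B) u v)) - (apConn (T \ B) s t * (1 - apConn (T \ (T \ B)) u v))) * (g B - g (T \ B))) =
      ∑ B ∈ T.powerset, q ^ apExp T B * (apConn B s t * (1 - apConn (T \ B) u v) * (g B - g (T \ B))) -
        ∑ B ∈ T.powerset, q ^ apExp T B * (apConn (T \ B) s t * (1 - apConn B u v) * (g B - g (T \ B))) := by
    rw [← Finset.sum_sub_distrib]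
    refine Finset.sum_congr rfl fun B hB => ?_
    rw [Finset.sdiff_sdiff_eq_self (Finset.mem_powerset.1 hB)]; ring
  rw [e3]
  linarith

/-- The test function `B ↦ 1{s ↔ t in B} · 1{u ↮ v in T ∖ B}` is monotone on the subsets of `T`. [cite: Grimmett2006, §2.1 (increasing events)] -/
theorem crossIndicator_mono (T : Finset (Sym2 V)) (s t u v : V) :
    ∀ ⦃A B : Finset (Sym2 V)⦄, A ⊆ B → B ⊆ T →
      apConn A s t * (1 - apConn (T \ A) u v) ≤ apConn B s t * (1 - apConn (T \ B) u v) := by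
  intro A B hAB _
  have h1 : apConn A s t ≤ apConn B s t := apConn_mono hAB s t
  have h2 : apConn (T \ B) u v ≤ apConn (T \ A) u v := apConn_mono (Finset.sdiff_subset_sdiff subset_rfl hAB) u v
  have h3 := apConn_nonneg A s t
  have h4 := apConn_le_one (T \ A) u v
  have h5 := apConn_nonneg B s t
  nlinarith

/-- **The cross functional is nonnegative for `q ≥ 1`, on every finite graph** (FKG for the antipodal weight, via
`apPsi_nonneg_of_one_le`). [cite: FortuinKasteleynGinibre1971, Thm. (Prop. 1)] [cite: Grimmett2006, Thm. 3.8 (p. 40)] -/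
theorem apX2_nonneg_of_one_le {q : ℝ} (hq : 1 ≤ q) (T : Finset (Sym2 V)) (s t u v : V) {g : Finset (Sym2 V) → ℝ}
    (hg : ∀ ⦃A B : Finset (Sym2 V)⦄, A ⊆ B → B ⊆ T → g A ≤ g B) : 0 ≤ apX2 q T s t u v g := by
  rw [apX2_eq_half_apPsi]
  exact mul_nonneg (by norm_num) (apPsi_nonneg_of_one_le hq T (crossIndicator_mono T s t u v) hg)

end CrossForm

/-! ### The `(1 - q)`-factorisation of the split functional -/

section Factorisation

variable [Fintype V]

/-- Opening the marked edge on a configuration: `q · q^{k(B ∪ {uv})} = q^{k(B)} · (q·1{u ↔ v in B} + 1{u ↮ v in B})`, from the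
edge-insertion identity `k(B ∪ {uv}) + 1{u ↮ v in B} = k(B)` (`clusterCount_insert`). [cite: Grimmett2006, §1.2; Thm. 3.8 eq. (3.12)] -/
theorem pow_clusterCount_insert (q : ℝ) (B : Finset (Sym2 V)) (u v : V) :
    q * q ^ clusterCount (↑(insert s(u, v) B) : BondConfig V) ∅ =
      q ^ clusterCount (↑B : BondConfig V) ∅ * (q * apConn B u v + (1 - apConn B u v)) := by
  have h := clusterCount_insert B u v (∅ : Set V)
  simp only [wired_empty, sup_bot_eq] at h
  by_cases hr : (openGraph (↑B : BondConfig V)).Reachable u v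
  · rw [if_pos hr, add_zero] at h
    rw [apConn_of_reachable hr, h]; ring
  · rw [if_neg hr] at h
    rw [apConn_of_not_reachable hr, ← h, pow_succ]; ring

/-- **The factorisation `q · apV = q · apUpc + (1 - q) · apX2`.**  Per configuration `B ⊆ T`: `q · q^{k(B)+k((T∖B) ∪ uv)} =
q^{k(B)+k(T∖B)} (q + (1 - q)·1{u ↮ v in T∖B})`, and `∑_B q^{k+k̄} 1{s↔t in B}(g(B) - g(T∖B)) = apUpc q T s t g` by the symmetry
`B ↦ T ∖ B`.  For `q ≤ 1` both coefficients `q`, `1 - q` are nonnegative. [cite: Grimmett2006, §1.4 eq. (1.20); §1.2] -/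
theorem apV_eq (q : ℝ) (T : Finset (Sym2 V)) (s t u v : V) (g : Finset (Sym2 V) → ℝ) :
    q * apV q T s t u v g = q * apUpc q T s t g + (1 - q) * apX2 q T s t u v g := by
  -- `apUpc` in the `1{s↔t in B}(g(B) - g(T∖B))` form (flip symmetry `B ↦ T ∖ B`)
  have hU : apUpc q T s t g = ∑ B ∈ T.powerset, q ^ apExp T B * (apConn B s t * (g B - g (T \ B))) := by
    unfold apUpc
    have flip := sum_powerset_flip T (fun B => q ^ apExp T B * (apConn B s t * g (T \ B)))
    have e1 : ∑ B ∈ T.powerset, q ^ apExp T (T \ B) * (apConn (T \ B) s t * g (T \ (T \ B))) =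
        ∑ B ∈ T.powerset, q ^ apExp T B * (apConn (T \ B) s t * g B) := by
      refine Finset.sum_congr rfl fun B hB => ?_
      have hBT := Finset.mem_powerset.1 hB
      rw [Finset.sdiff_sdiff_eq_self hBT, apExp_compl hBT]
    rw [e1] at flip
    have e2 : ∀ B ∈ T.powerset, q ^ apExp T B * (apConn B s t * (g B - g (T \ B))) =
        q ^ apExp T B * ((apConn B s t - apConn (T \ B) s t) * g B) +
          (q ^ apExp T B * (apConn (T \ B) s t * g B) - q ^ apExp T B * (apConn B s t * g (T \ B))) := fun B _ => by ring
    rw [Finset.sum_congr rfl e2, Finset.sum_add_distrib, Finset.sum_sub_distrib, flip, sub_self, add_zero]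
  rw [hU]
  unfold apV apX2
  rw [Finset.mul_sum, Finset.mul_sum, Finset.mul_sum, ← Finset.sum_add_distrib]
  refine Finset.sum_congr rfl fun B hB => ?_
  have key := pow_clusterCount_insert q (T \ B) u v
  unfold apExp
  rw [pow_add, pow_add]
  have : q * (q ^ clusterCount (↑B : BondConfig V) ∅ *
      q ^ clusterCount (↑(insert s(u, v) (T \ B)) : BondConfig V) ∅ * (apConn B s t * (g B - g (T \ B)))) =
      q ^ clusterCount (↑B : BondConfig V) ∅ * (q * q ^ clusterCount (↑(insert s(u, v) (T \ B)) : BondConfig V) ∅) *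
        (apConn B s t * (g B - g (T \ B))) := by ring
  rw [this, key]; ring

/-- **`apX2 ≥ 0` implies `apV ≥ 0` (`0 < q ≤ 1`) on sub-networks of two-terminal series–parallel networks**: by the factorisation
and Theorem U (`apUpc_nonneg_of_isTTSP`, every `q > 0`).  This is the reduction of the split up-correlation inequality for `y · M`
to the node `ApX2Pos`. [cite: Grimmett2006, §3.8 (pp. 61–62); §3.9 (p. 63)] -/
theorem apV_nonneg_of_apX2_nonneg {q : ℝ} (hq0 : 0 < q) (hq1 : q ≤ 1) {E T : Finset (Sym2 V)} {s t : V} (hE : IsTTSP E s t)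
    (hT : T ⊆ E) (u v : V) {g : Finset (Sym2 V) → ℝ} (hg : ∀ ⦃A B : Finset (Sym2 V)⦄, A ⊆ B → B ⊆ T → g A ≤ g B)
    (hX : 0 ≤ apX2 q T s t u v g) : 0 ≤ apV q T s t u v g := by
  have hU := apUpc_nonneg_of_isTTSP hq0 hE T hT g hg
  have h := apV_eq q T s t u v g
  have : 0 ≤ q * apV q T s t u v g := by
    rw [h]; exact add_nonneg (mul_nonneg hq0.le hU) (mul_nonneg (by linarith) hX)
  exact (mul_nonneg_iff_of_pos_left hq0).1 this

/-- **Under the node `ApX2Pos`, the split functional is nonnegative for all `0 < q ≤ 1`** on two-terminal series–parallel networks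
with a marked edge (`T = E ∖ {uv}`). [cite: Grimmett2006, §3.9 (p. 63)] -/
theorem apV_nonneg_of_apX2Pos (hX : ApX2Pos) {n : ℕ} {q : ℝ} (hq0 : 0 < q) (hq1 : q ≤ 1) {E : Finset (Sym2 (Fin n))}
    {s t u v : Fin n} (hE : IsTTSP E s t) (huv : s(u, v) ∈ E) {g : Finset (Sym2 (Fin n)) → ℝ}
    (hg : ∀ ⦃A B : Finset (Sym2 (Fin n))⦄, A ⊆ B → B ⊆ E.erase s(u, v) → g A ≤ g B) :
    0 ≤ apV q (E.erase s(u, v)) s t u v g :=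
  apV_nonneg_of_apX2_nonneg hq0 hq1 hE (Finset.erase_subset _ E) u v hg
    (hX n q hq0 E s t u v hE huv (E.erase s(u, v)) subset_rfl g hg)

end Factorisation

end FK

end Summit.CriticalPhenomena.PercolationContinuityZ3.Theorems

end
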